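import Summits.NavierStokesRegularity.NavierStokesRegularity.Theorems.PerpetualPumpCircuitPumpTruncStructure
import Literature.Analysis.ODE.OneSidedComparison

/-!
# Trail slaving for truncated Toda solutions (crux `PerpetualPump.CircuitPump`,
# stmt-NavierStokesRegularity-1834; line `singular-clock-gspt`, sub-goal `toda_trail_slaving`)

Pure real analysis for the `L`-truncated seeded graded Toda lattice (carrier `a n`, bond `b n`,
modes `|n| > L` read as `0` on `[0, T]`, right derivatives on `[0, T)`):
`ȧ_n = -lam^{4n/5} a_n - lamⁿ b_n² + lam^{n-1} b_{n-1}² - ε lamⁿ a_n b_n`,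
`ḃ_n = -lam^{4n/5} b_n + lamⁿ b_n (a_n - a_{n+1}) + ε lamⁿ a_n²`, `1 < lam ≤ 2`, `q = lam^{1/5}`.
Behind the active scale (`a 0 ≥ -R₀`) the TRAIL `n = -j`, `j ≥ 1`, starting in the geometric box
`|a(-j)| ≤ ρ̄ qʲ (2 - lam^{-4j/5})`, `0 ≤ b(-j) ≤ σ̄ qʲ`, is slaved over the window `[0, T]`
(`toda_trail_slaving`):

* `trail_bond_bound`: under the crude envelope `|a(-i)| ≤ 2 ρ̄ qⁱ` the bond rate is
  `lam^{-j} (a(-j) - a(-j+1)) - lam^{-4j/5} ≤ 4ρ̄ + R₀ =: Γ` and the seed is `≤ 4 ε ρ̄² qʲ`, so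
  `b(-j)(t) ≤ (b(-j)(0) + 4ερ̄² qʲ t) e^{Γ t}` (Mathlib's `gronwallBound` via the tree lemma
  `Literature.Analysis.ODE.le_gronwallBound_of_deriv_right_le`);
* `trail_carrier_bound`: the damping terms of `ȧ(-j)` have the sign of `-a(-j)`, so the modulus
  only moves by the two adjacent bond fluxes (`abs_le_abs_add_mul_of_sign_fence`, a signed version
  of Mathlib's fencing theorem `image_le_of_deriv_right_lt_deriv_boundary'`), which are
  `≤ F qʲ lam^{-4j/5}`, `F = 2 (σ̄ + 4ερ̄²T)² e^{2ΓT}`;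
* the envelope is then recovered with room (`F T ≤ ρ̄ / 2`), and the continuity argument
  (`Literature.Analysis.ODE.maximalTimeP` on the finite conjunction over the live scales `j ≤ L`)
  closes the bootstrap. Bond positivity is `toda_trunc_structure`.
[folklore]
-/

noncomputable section

-- the summit namespace `…NavierStokesRegularity.NavierStokesRegularity…` is the tree convention
set_option linter.dupNamespace false

namespace Summit.NavierStokesRegularity.NavierStokesRegularity.Theorems.PerpetualPumpCircuitPump

open Set Filter Topology
open Literature.Analysis.ODE

/-! ## Signed fences -/

/-- **One-sided signed fence.** If `f' ≤ Φ` wherever `f ≥ 0` (`Φ ≥ 0`), then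
`f x ≤ |f a| + Φ (x - a)` on `[a, b]` (fence `|f a| + η + (Φ + η)(x - a)`, `η ↓ 0`). [folklore] -/
theorem le_abs_add_mul_of_deriv_right_le {f f' : ℝ → ℝ} {a b Φ : ℝ}
    (hf : ContinuousOn f (Icc a b)) (hf' : ∀ x ∈ Ico a b, HasDerivWithinAt f (f' x) (Ici x) x)
    (hΦ : 0 ≤ Φ) (hup : ∀ x ∈ Ico a b, 0 ≤ f x → f' x ≤ Φ) :
    ∀ x ∈ Icc a b, f x ≤ |f a| + Φ * (x - a) := by
  intro x hx
  have hba : 0 < b - a + 1 := by linarith [hx.1.trans hx.2]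
  refine le_of_forall_pos_le_add fun δ hδ => ?_
  set η : ℝ := δ / (b - a + 1) with hη
  have hη0 : 0 < η := div_pos hδ hba
  have hB : ∀ y, HasDerivAt (fun y => |f a| + η + (Φ + η) * (y - a)) (Φ + η) y := fun y => by
    simpa using ((hasDerivAt_id y).sub_const a).const_mul (Φ + η) |>.const_add (|f a| + η)
  have key := image_le_of_deriv_right_lt_deriv_boundary' hf hf'
    (B := fun y => |f a| + η + (Φ + η) * (y - a)) (B' := fun _ => Φ + η)
    (by simp only [sub_self, mul_zero, add_zero]; linarith [le_abs_self (f a)])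
    (fun y _ => (hB y).continuousAt.continuousWithinAt) (fun y _ => (hB y).hasDerivWithinAt)
    (fun y hy hfy => by
      have h0 : 0 ≤ f y := by
        rw [hfy]
        have := mul_nonneg (add_nonneg hΦ hη0.le) (sub_nonneg.2 hy.1)
        linarith [abs_nonneg (f a)]
      have := hup y hy h0
      show f' y < Φ + η; linarith) hx
  have hle : η * (x - a + 1) ≤ δ := by
    rw [hη, div_mul_eq_mul_div, div_le_iff₀ hba]
    exact mul_le_mul_of_nonneg_left (by linarith [hx.2]) hδ.le
  linarith

/-- **Two-sided signed fence.** If `f' ≤ Φ` wherever `f ≥ 0` and `-Φ ≤ f'` wherever `f ≤ 0`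
(`Φ ≥ 0`), then `|f x| ≤ |f a| + Φ (x - a)` on `[a, b]`: the modulus grows at most at rate `Φ`
even though `|f'|` may be large (damping). [folklore] -/
theorem abs_le_abs_add_mul_of_sign_fence {f f' : ℝ → ℝ} {a b Φ : ℝ}
    (hf : ContinuousOn f (Icc a b)) (hf' : ∀ x ∈ Ico a b, HasDerivWithinAt f (f' x) (Ici x) x)
    (hΦ : 0 ≤ Φ) (hup : ∀ x ∈ Ico a b, 0 ≤ f x → f' x ≤ Φ)
    (hdown : ∀ x ∈ Ico a b, f x ≤ 0 → -Φ ≤ f' x) :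
    ∀ x ∈ Icc a b, |f x| ≤ |f a| + Φ * (x - a) := by
  intro x hx
  have h1 := le_abs_add_mul_of_deriv_right_le hf hf' hΦ hup x hx
  have h2 := le_abs_add_mul_of_deriv_right_le (f := fun y => -f y) (f' := fun y => -f' y) hf.neg
    (fun y hy => (hf' y hy).neg) hΦ
    (fun y hy h0 => by have := hdown y hy (by linarith); linarith) x hx
  rw [abs_neg] at h2
  exact abs_le.2 ⟨by linarith, h1⟩

/-! ## The two slaving steps -/

/-- **Trail bond step.** A bond `β ≥ 0` driven by `β' = -P₁ β + P₂ β (α - α₁) + ε P₂ α²` with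
`|α| ≤ M`, `-α₁ ≤ M₁`, `P₂ (M + M₁) ≤ Γ` and `ε P₂ M² ≤ S` obeys `β' ≤ Γ β + S`, hence
`β(s) ≤ (β(0) + S s) e^{Γ s}`. [folklore] -/
theorem trail_bond_bound {β α α₁ : ℝ → ℝ} {t₁ P₁ P₂ ε M M₁ Γ S : ℝ}
    (hβc : ContinuousOn β (Icc 0 t₁))
    (hβd : ∀ s ∈ Ico 0 t₁,
      HasDerivWithinAt β (-P₁ * β s + P₂ * β s * (α s - α₁ s) + ε * P₂ * α s ^ 2) (Ici s) s)
    (hβ0 : ∀ s ∈ Icc 0 t₁, 0 ≤ β s) (hα : ∀ s ∈ Icc 0 t₁, |α s| ≤ M)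
    (hα₁ : ∀ s ∈ Icc 0 t₁, -α₁ s ≤ M₁) (hP₁ : 0 ≤ P₁) (hP₂ : 0 ≤ P₂) (hε : 0 ≤ ε)
    (hΓ : P₂ * (M + M₁) ≤ Γ) (hΓ0 : 0 ≤ Γ) (hS : ε * P₂ * M ^ 2 ≤ S) (hS0 : 0 ≤ S) :
    ∀ s ∈ Icc 0 t₁, β s ≤ (β 0 + S * s) * Real.exp (Γ * s) := by
  have hbound : ∀ x ∈ Ico 0 t₁,
      -P₁ * β x + P₂ * β x * (α x - α₁ x) + ε * P₂ * α x ^ 2 ≤ Γ * β x + S := by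
    intro x hx
    have hx' : x ∈ Icc 0 t₁ := Ico_subset_Icc_self hx
    have hb := hβ0 x hx'
    have h1 : α x - α₁ x ≤ M + M₁ := by linarith [le_abs_self (α x), hα x hx', hα₁ x hx']
    have h2 : β x * (P₂ * (α x - α₁ x)) ≤ β x * Γ :=
      mul_le_mul_of_nonneg_left ((mul_le_mul_of_nonneg_left h1 hP₂).trans hΓ) hb
    have h3 : α x ^ 2 ≤ M ^ 2 := sq_le_sq' (abs_le.1 (hα x hx')).1 (abs_le.1 (hα x hx')).2
    have h4 : ε * P₂ * α x ^ 2 ≤ S := (mul_le_mul_of_nonneg_left h3 (mul_nonneg hε hP₂)).trans hS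
    have h5 : 0 ≤ P₁ * β x := mul_nonneg hP₁ hb
    linarith
  intro s hs
  have key := le_gronwallBound_of_deriv_right_le hβc hβd hbound s hs
  exact (sub_zero s ▸ key).trans (gronwallBound_le_mul_exp hS0 hΓ0)

/-- **Trail carrier step.** A carrier driven by `α' = -P₁ α - P₂ β² + P₃ β₂² - ε P₂ α β` with
non-negative bonds `β ≤ B₁`, `β₂ ≤ B₂` and `P₂ B₁² ≤ Φ`, `P₃ B₂² ≤ Φ`: the damping terms have the
sign of `-α`, so `|α(s)| ≤ |α(0)| + Φ s` (`abs_le_abs_add_mul_of_sign_fence`). [folklore] -/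
theorem trail_carrier_bound {α β β₂ : ℝ → ℝ} {t₁ P₁ P₂ P₃ ε B₁ B₂ Φ : ℝ}
    (hαc : ContinuousOn α (Icc 0 t₁))
    (hαd : ∀ s ∈ Ico 0 t₁, HasDerivWithinAt α
      (-P₁ * α s - P₂ * β s ^ 2 + P₃ * β₂ s ^ 2 - ε * P₂ * α s * β s) (Ici s) s)
    (hβ : ∀ s ∈ Icc 0 t₁, 0 ≤ β s ∧ β s ≤ B₁) (hβ₂ : ∀ s ∈ Icc 0 t₁, 0 ≤ β₂ s ∧ β₂ s ≤ B₂)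
    (hP₁ : 0 ≤ P₁) (hP₂ : 0 ≤ P₂) (hP₃ : 0 ≤ P₃) (hε : 0 ≤ ε) (hΦ : 0 ≤ Φ)
    (hΦ₁ : P₂ * B₁ ^ 2 ≤ Φ) (hΦ₂ : P₃ * B₂ ^ 2 ≤ Φ) :
    ∀ s ∈ Icc 0 t₁, |α s| ≤ |α 0| + Φ * s := by
  have hup : ∀ x ∈ Ico 0 t₁, 0 ≤ α x →
      -P₁ * α x - P₂ * β x ^ 2 + P₃ * β₂ x ^ 2 - ε * P₂ * α x * β x ≤ Φ := by
    intro x hx h0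
    obtain ⟨hb0, -⟩ := hβ x (Ico_subset_Icc_self hx)
    obtain ⟨hc0, hc1⟩ := hβ₂ x (Ico_subset_Icc_self hx)
    have h1 : P₃ * β₂ x ^ 2 ≤ Φ :=
      (mul_le_mul_of_nonneg_left (pow_le_pow_left₀ hc0 hc1 2) hP₃).trans hΦ₂
    have h2 : 0 ≤ P₁ * α x := mul_nonneg hP₁ h0
    have h3 : 0 ≤ P₂ * β x ^ 2 := mul_nonneg hP₂ (sq_nonneg _)
    have h4 : 0 ≤ ε * P₂ * α x * β x := mul_nonneg (mul_nonneg (mul_nonneg hε hP₂) h0) hb0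
    linarith
  have hdown : ∀ x ∈ Ico 0 t₁, α x ≤ 0 →
      -Φ ≤ -P₁ * α x - P₂ * β x ^ 2 + P₃ * β₂ x ^ 2 - ε * P₂ * α x * β x := by
    intro x hx h0
    obtain ⟨hb0, hb1⟩ := hβ x (Ico_subset_Icc_self hx)
    obtain ⟨hc0, -⟩ := hβ₂ x (Ico_subset_Icc_self hx)
    have h1 : P₂ * β x ^ 2 ≤ Φ :=
      (mul_le_mul_of_nonneg_left (pow_le_pow_left₀ hb0 hb1 2) hP₂).trans hΦ₁
    have h2 : 0 ≤ P₁ * -α x := mul_nonneg hP₁ (neg_nonneg.2 h0)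
    have h3 : 0 ≤ P₃ * β₂ x ^ 2 := mul_nonneg hP₃ (sq_nonneg _)
    have h4 : 0 ≤ ε * P₂ * -α x * β x :=
      mul_nonneg (mul_nonneg (mul_nonneg hε hP₂) (neg_nonneg.2 h0)) hb0
    linarith
  intro s hs
  simpa only [sub_zero] using abs_le_abs_add_mul_of_sign_fence hαc hαd hΦ hup hdown s hs

/-! ## Trail slaving -/

/-- **TRAIL SLAVING.** For an `L`-truncated seeded Toda solution on `[0,T]` (`1 < lam ≤ 2`,
`q = lam^{1/5}`, `0 ≤ ε ≤ 1`, bonds non-negative initially) whose ACTIVE carrier `a 0` never drops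
below `−R₀`, and whose trail (scales `−j`, `j ≥ 1`) starts in the geometric box
`|a(−j)| ≤ ρ̄ qʲ (2 − lam^{−4j/5})`, `0 ≤ b(−j) ≤ σ̄ qʲ`: every trail bond grows at most at the
bounded rate `Γ = 4ρ̄ + R₀` from its initial value plus the seed `4ε ρ̄² qʲ t`, and every trail
carrier moves by at most the fluxes of the two adjacent bonds, `F qʲ lam^{−4j/5} t` with
`F = 2 (σ̄ + 4ερ̄²T)² e^{2ΓT}` — provided `F T ≤ ρ̄/2` (so the crude envelope `|a(−j)| ≤ 2ρ̄qʲ`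
persists). This is the "frozen trail": with `σ̄` polynomially small in `ε` the fluxes are
negligible and the renormalised trail sections map INTO themselves. [folklore] -/
theorem toda_trail_slaving :
    ∀ (lam ε T R₀ ρb σb : ℝ) (L : ℕ) (a b : ℤ → ℝ → ℝ),
    1 < lam → lam ≤ 2 → 0 ≤ ε → ε ≤ 1 → 0 < T → T ≤ 1 / 2 → 0 ≤ R₀ → 1 ≤ ρb → 0 ≤ σb →
    2 * (σb + 4 * ε * ρb ^ 2 * T) ^ 2 * Real.exp (2 * (4 * ρb + R₀) * T) * T ≤ ρb / 2 →
    (∀ n : ℤ, (L : ℤ) < |n| → ∀ t ∈ Set.Icc 0 T, a n t = 0 ∧ b n t = 0) →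
    (∀ n : ℤ, |n| ≤ (L : ℤ) → ContinuousOn (a n) (Set.Icc 0 T) ∧ ContinuousOn (b n) (Set.Icc 0 T)) →
    (∀ n : ℤ, |n| ≤ (L : ℤ) → ∀ t ∈ Set.Ico 0 T,
      HasDerivWithinAt (a n)
        (-(lam ^ ((4 / 5 : ℝ) * n)) * a n t - lam ^ (n : ℝ) * b n t ^ 2 +
          lam ^ ((n : ℝ) - 1) * b (n - 1) t ^ 2 - ε * lam ^ (n : ℝ) * a n t * b n t) (Set.Ici t) t ∧
      HasDerivWithinAt (b n)
        (-(lam ^ ((4 / 5 : ℝ) * n)) * b n t + lam ^ (n : ℝ) * b n t * (a n t - a (n + 1) t) +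
          ε * lam ^ (n : ℝ) * a n t ^ 2) (Set.Ici t) t) →
    (∀ n : ℤ, 0 ≤ b n 0) →
    (∀ t ∈ Set.Icc 0 T, -R₀ ≤ a 0 t) →
    (∀ j : ℕ, 1 ≤ j →
      |a (-(j : ℤ)) 0| ≤ ρb * lam ^ ((j : ℝ) / 5) * (2 - lam ^ (-(4 / 5 : ℝ) * j)) ∧
      b (-(j : ℤ)) 0 ≤ σb * lam ^ ((j : ℝ) / 5)) →
    ∀ t ∈ Set.Icc 0 T, ∀ j : ℕ, 1 ≤ j →
      0 ≤ b (-(j : ℤ)) t ∧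
      b (-(j : ℤ)) t ≤ (b (-(j : ℤ)) 0 + 4 * ε * ρb ^ 2 * lam ^ ((j : ℝ) / 5) * t) *
        Real.exp ((4 * ρb + R₀) * t) ∧
      |a (-(j : ℤ)) t| ≤ |a (-(j : ℤ)) 0| +
        2 * (σb + 4 * ε * ρb ^ 2 * T) ^ 2 * Real.exp (2 * (4 * ρb + R₀) * T) *
          lam ^ ((j : ℝ) / 5) * lam ^ (-(4 / 5 : ℝ) * j) * t := by
  intro lam ε T R₀ ρb σb L a b hlam1 _hlam2 hε0 _hε1 hT _hT2 hR₀ hρb hσb hFT hzero hcont hode hb0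
    ha0 hinit
  have hlam0 : 0 < lam := by linarith
  have hρ0 : 0 < ρb := by linarith
  -- all modes are continuous on `[0, T]`; all bonds stay non-negative (`toda_trunc_structure`)
  have hall : ∀ n : ℤ, ContinuousOn (a n) (Icc 0 T) ∧ ContinuousOn (b n) (Icc 0 T) := by
    intro n
    rcases le_or_gt |n| (L : ℤ) with hn | hn
    · exact hcont n hn
    · exact ⟨(continuousOn_const (c := (0 : ℝ))).congr fun s hs => (hzero n hn s hs).1,
        (continuousOn_const (c := (0 : ℝ))).congr fun s hs => (hzero n hn s hs).2⟩
  have hbpos : ∀ n : ℤ, ∀ t ∈ Icc 0 T, 0 ≤ b n t :=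
    (toda_trunc_structure lam ε T L a b hlam0 hε0 hT hzero hcont hode hb0).1
  -- index and `rpow` bookkeeping
  have habs : ∀ j : ℕ, |(-(j : ℤ))| = (j : ℤ) := fun j => by rw [abs_neg, Nat.abs_cast]
  have hcast : ∀ j : ℕ, ((-(j : ℤ) : ℤ) : ℝ) = -(j : ℝ) := fun j => by
    simp only [Int.cast_neg, Int.cast_natCast]
  have hrp : ∀ x : ℝ, 0 < lam ^ x := fun x => Real.rpow_pos_of_pos hlam0 x
  have hradd : ∀ x y : ℝ, lam ^ x * lam ^ y = lam ^ (x + y) := fun x y =>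
    (Real.rpow_add hlam0 x y).symm
  have hrle : ∀ x y : ℝ, x ≤ y → lam ^ x ≤ lam ^ y := fun x y =>
    Real.rpow_le_rpow_of_exponent_le hlam1.le
  have hr1 : ∀ x : ℝ, x ≤ 0 → lam ^ x ≤ 1 := fun x => Real.rpow_le_one_of_one_le_of_nonpos hlam1.le
  have hΓ0 : 0 ≤ 4 * ρb + R₀ := by positivity
  have hF0 : 0 ≤ 2 * (σb + 4 * ε * ρb ^ 2 * T) ^ 2 * Real.exp (2 * (4 * ρb + R₀) * T) := by
    positivity
  have hE2 : Real.exp ((4 * ρb + R₀) * T) ^ 2 = Real.exp (2 * (4 * ρb + R₀) * T) := by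
    rw [sq, ← Real.exp_add]; congr 1; ring
  set Γ : ℝ := 4 * ρb + R₀ with hΓ
  set σ' : ℝ := σb + 4 * ε * ρb ^ 2 * T with hσ'
  set F : ℝ := 2 * σ' ^ 2 * Real.exp (2 * Γ * T) with hF
  /- CORE: on a window `[0, t₁]` where the crude envelope `|a(-j)| ≤ 2ρ̄ qʲ` holds, the bond and
  carrier bounds of the statement hold. -/
  have core : ∀ t₁, t₁ ≤ T →
      (∀ s ∈ Icc 0 t₁, ∀ j : ℕ, 1 ≤ j → |a (-(j : ℤ)) s| ≤ 2 * ρb * lam ^ ((j : ℝ) / 5)) →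
      ∀ s ∈ Icc 0 t₁, ∀ j : ℕ, 1 ≤ j →
        b (-(j : ℤ)) s ≤ (b (-(j : ℤ)) 0 + 4 * ε * ρb ^ 2 * lam ^ ((j : ℝ) / 5) * s) *
          Real.exp (Γ * s) ∧
        |a (-(j : ℤ)) s| ≤ |a (-(j : ℤ)) 0| +
          F * lam ^ ((j : ℝ) / 5) * lam ^ (-(4 / 5 : ℝ) * j) * s := by
    intro t₁ ht₁ henv
    have hI : ∀ {s}, s ∈ Icc 0 t₁ → s ∈ Icc 0 T := fun hs => ⟨hs.1, hs.2.trans ht₁⟩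
    have hI' : ∀ {s}, s ∈ Ico 0 t₁ → s ∈ Ico 0 T := fun hs => ⟨hs.1, hs.2.trans_le ht₁⟩
    -- lower envelope, including the active carrier (`i = 0`)
    have hlow : ∀ s ∈ Icc 0 t₁, ∀ i : ℕ, -a (-(i : ℤ)) s ≤ R₀ + 2 * ρb * lam ^ ((i : ℝ) / 5) := by
      intro s hs i
      rcases Nat.eq_zero_or_pos i with rfl | hi
      · have h := ha0 s (hI hs)
        simp only [Nat.cast_zero, neg_zero, zero_div, Real.rpow_zero, mul_one]
        linarith
      · have h := henv s hs i hi
        linarith [neg_abs_le (a (-(i : ℤ)) s), (hrp ((i : ℝ) / 5)).le]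
    -- (1) trail bonds: bounded rate `Γ`, seed `4ερ̄² qʲ`
    have hbond : ∀ j : ℕ, 1 ≤ j → ∀ s ∈ Icc 0 t₁,
        b (-(j : ℤ)) s ≤ (b (-(j : ℤ)) 0 + 4 * ε * ρb ^ 2 * lam ^ ((j : ℝ) / 5) * s) *
          Real.exp (Γ * s) := by
      intro j hj s hs
      rcases le_or_gt j L with hjL | hjL
      · obtain ⟨i, rfl⟩ : ∃ i, j = i + 1 := ⟨j - 1, by omega⟩
        have hn : |(-((i + 1 : ℕ) : ℤ))| ≤ (L : ℤ) := by rw [habs]; exact_mod_cast hjL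
        have hidx : -((i + 1 : ℕ) : ℤ) + 1 = -(i : ℤ) := by push_cast; ring
        have hi0 : (0 : ℝ) ≤ i := Nat.cast_nonneg i
        have e1 : lam ^ (-((i : ℝ) + 1)) * lam ^ (((i : ℝ) + 1) / 5) ≤ 1 := by
          rw [hradd]; exact hr1 _ (by linarith)
        have hrate : lam ^ (((-((i + 1 : ℕ) : ℤ)) : ℤ) : ℝ) *
            (2 * ρb * lam ^ (((i + 1 : ℕ) : ℝ) / 5) + (R₀ + 2 * ρb * lam ^ ((i : ℝ) / 5))) ≤ Γ := by
          rw [hcast]; push_cast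
          have e2 : lam ^ (-((i : ℝ) + 1)) * lam ^ ((i : ℝ) / 5) ≤ 1 := by
            rw [hradd]; exact hr1 _ (by linarith)
          have e3 : lam ^ (-((i : ℝ) + 1)) ≤ 1 := hr1 _ (by linarith)
          have f1 := mul_le_mul_of_nonneg_left e1 (by positivity : (0 : ℝ) ≤ 2 * ρb)
          have f2 := mul_le_mul_of_nonneg_left e2 (by positivity : (0 : ℝ) ≤ 2 * ρb)
          have f3 := mul_le_mul_of_nonneg_left e3 hR₀
          rw [hΓ]
          linarith
        have hseed : ε * lam ^ (((-((i + 1 : ℕ) : ℤ)) : ℤ) : ℝ) *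
            (2 * ρb * lam ^ (((i + 1 : ℕ) : ℝ) / 5)) ^ 2 ≤
            4 * ε * ρb ^ 2 * lam ^ (((i + 1 : ℕ) : ℝ) / 5) := by
          rw [hcast]; push_cast
          calc ε * lam ^ (-((i : ℝ) + 1)) * (2 * ρb * lam ^ (((i : ℝ) + 1) / 5)) ^ 2
              = 4 * ε * ρb ^ 2 * lam ^ (((i : ℝ) + 1) / 5) *
                  (lam ^ (-((i : ℝ) + 1)) * lam ^ (((i : ℝ) + 1) / 5)) := by ring
            _ ≤ 4 * ε * ρb ^ 2 * lam ^ (((i : ℝ) + 1) / 5) :=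
                mul_le_of_le_one_right (by positivity) e1
        exact trail_bond_bound (β := b (-((i + 1 : ℕ) : ℤ))) (α := a (-((i + 1 : ℕ) : ℤ)))
          (α₁ := a (-((i + 1 : ℕ) : ℤ) + 1)) (M₁ := R₀ + 2 * ρb * lam ^ ((i : ℝ) / 5))
          ((hall _).2.mono (Icc_subset_Icc_right ht₁)) (fun s hs => (hode _ hn s (hI' hs)).2)
          (fun s hs => hbpos _ s (hI hs)) (fun s hs => henv s hs _ hj)
          (fun s hs => by rw [hidx]; exact hlow s hs i) (hrp _).le (hrp _).le hε0
          hrate hΓ0 hseed (by positivity) s hs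
      · have hn : (L : ℤ) < |(-(j : ℤ))| := by rw [habs]; exact_mod_cast hjL
        rw [(hzero _ hn s (hI hs)).2, (hzero _ hn 0 ⟨le_rfl, hT.le⟩).2, zero_add]
        have := hs.1; positivity
    -- (2) hence the uniform bond envelope `b(-j) ≤ σ' qʲ e^{ΓT}` on the window
    have hbond' : ∀ j : ℕ, 1 ≤ j → ∀ s ∈ Icc 0 t₁,
        0 ≤ b (-(j : ℤ)) s ∧ b (-(j : ℤ)) s ≤ σ' * lam ^ ((j : ℝ) / 5) * Real.exp (Γ * T) := by
      intro j hj s hs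
      refine ⟨hbpos _ s (hI hs), (hbond j hj s hs).trans ?_⟩
      have h1 : b (-(j : ℤ)) 0 ≤ σb * lam ^ ((j : ℝ) / 5) := (hinit j hj).2
      have h2 : Real.exp (Γ * s) ≤ Real.exp (Γ * T) :=
        Real.exp_le_exp.2 (mul_le_mul_of_nonneg_left (hs.2.trans ht₁) hΓ0)
      have h3 : 4 * ε * ρb ^ 2 * lam ^ ((j : ℝ) / 5) * s ≤
          4 * ε * ρb ^ 2 * lam ^ ((j : ℝ) / 5) * T :=
        mul_le_mul_of_nonneg_left (hs.2.trans ht₁) (by positivity)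
      have h4 : 0 ≤ b (-(j : ℤ)) 0 + 4 * ε * ρb ^ 2 * lam ^ ((j : ℝ) / 5) * s := by
        have := hb0 (-(j : ℤ)); have := hs.1; positivity
      calc (b (-(j : ℤ)) 0 + 4 * ε * ρb ^ 2 * lam ^ ((j : ℝ) / 5) * s) * Real.exp (Γ * s)
          ≤ (σb * lam ^ ((j : ℝ) / 5) + 4 * ε * ρb ^ 2 * lam ^ ((j : ℝ) / 5) * T) *
              Real.exp (Γ * T) := mul_le_mul (by linarith) h2 (Real.exp_pos _).le (by linarith)
        _ = σ' * lam ^ ((j : ℝ) / 5) * Real.exp (Γ * T) := by rw [hσ']; ring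
    -- (3) trail carriers: only the two adjacent bond fluxes move `|a(-j)|`
    have hcarr : ∀ j : ℕ, 1 ≤ j → ∀ s ∈ Icc 0 t₁, |a (-(j : ℤ)) s| ≤ |a (-(j : ℤ)) 0| +
        F * lam ^ ((j : ℝ) / 5) * lam ^ (-(4 / 5 : ℝ) * j) * s := by
      intro j hj s hs
      rcases le_or_gt j L with hjL | hjL
      · have hn : |(-(j : ℤ))| ≤ (L : ℤ) := by rw [habs]; exact_mod_cast hjL
        have hidx : -(j : ℤ) - 1 = -((j + 1 : ℕ) : ℤ) := by push_cast; ring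
        have h0 : 0 ≤ σ' ^ 2 * Real.exp (2 * Γ * T) *
            (lam ^ ((j : ℝ) / 5) * lam ^ (-(4 / 5 : ℝ) * j)) := by positivity
        have hΦ₁ : lam ^ (((-(j : ℤ)) : ℤ) : ℝ) *
            (σ' * lam ^ ((j : ℝ) / 5) * Real.exp (Γ * T)) ^ 2 ≤
            F * lam ^ ((j : ℝ) / 5) * lam ^ (-(4 / 5 : ℝ) * j) := by
          rw [hcast]
          have e1 : lam ^ (-(j : ℝ)) * lam ^ ((j : ℝ) / 5) = lam ^ (-(4 / 5 : ℝ) * j) := by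
            rw [hradd]; congr 1; ring
          calc lam ^ (-(j : ℝ)) * (σ' * lam ^ ((j : ℝ) / 5) * Real.exp (Γ * T)) ^ 2
              = σ' ^ 2 * Real.exp (Γ * T) ^ 2 *
                  (lam ^ ((j : ℝ) / 5) * (lam ^ (-(j : ℝ)) * lam ^ ((j : ℝ) / 5))) := by ring
            _ ≤ F * lam ^ ((j : ℝ) / 5) * lam ^ (-(4 / 5 : ℝ) * j) := by
                rw [e1, hE2, hF]; linarith
        have hΦ₂ : lam ^ ((((-(j : ℤ)) : ℤ) : ℝ) - 1) *
            (σ' * lam ^ (((j + 1 : ℕ) : ℝ) / 5) * Real.exp (Γ * T)) ^ 2 ≤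
            F * lam ^ ((j : ℝ) / 5) * lam ^ (-(4 / 5 : ℝ) * j) := by
          rw [hcast]; push_cast
          have e1 : lam ^ (-(j : ℝ) - 1) * (lam ^ (((j : ℝ) + 1) / 5)) ^ 2 ≤
              lam ^ ((j : ℝ) / 5) * lam ^ (-(4 / 5 : ℝ) * j) := by
            rw [sq, hradd, hradd, hradd]; exact hrle _ _ (by linarith)
          calc lam ^ (-(j : ℝ) - 1) * (σ' * lam ^ (((j : ℝ) + 1) / 5) * Real.exp (Γ * T)) ^ 2
              = σ' ^ 2 * Real.exp (Γ * T) ^ 2 *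
                  (lam ^ (-(j : ℝ) - 1) * (lam ^ (((j : ℝ) + 1) / 5)) ^ 2) := by ring
            _ ≤ σ' ^ 2 * Real.exp (Γ * T) ^ 2 *
                  (lam ^ ((j : ℝ) / 5) * lam ^ (-(4 / 5 : ℝ) * j)) :=
                mul_le_mul_of_nonneg_left e1 (by positivity)
            _ ≤ F * lam ^ ((j : ℝ) / 5) * lam ^ (-(4 / 5 : ℝ) * j) := by
                rw [hE2, hF]; linarith
        exact trail_carrier_bound (α := a (-(j : ℤ))) (β := b (-(j : ℤ))) (β₂ := b (-(j : ℤ) - 1))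
          ((hall _).1.mono (Icc_subset_Icc_right ht₁)) (fun s hs => (hode _ hn s (hI' hs)).1)
          (hbond' j hj) (fun s hs => by rw [hidx]; exact hbond' (j + 1) (by omega) s hs)
          (hrp _).le (hrp _).le (hrp _).le hε0 (by positivity) hΦ₁ hΦ₂ s hs
      · have hn : (L : ℤ) < |(-(j : ℤ))| := by rw [habs]; exact_mod_cast hjL
        rw [(hzero _ hn s (hI hs)).1, (hzero _ hn 0 ⟨le_rfl, hT.le⟩).1, abs_zero, zero_add]
        have := hs.1; positivity
    exact fun s hs j hj => ⟨hbond j hj s hs, hcarr j hj s hs⟩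
  /- BOOTSTRAP on the crude envelope over the finitely many live trail scales `1 ≤ j ≤ L`. -/
  set P : ℝ → Prop := fun s => ∀ j ∈ Finset.Icc 1 L,
    |a (-(j : ℤ)) s| ≤ 2 * ρb * lam ^ ((j : ℝ) / 5) with hP
  have hP0 : P 0 := by
    simp only [hP]
    intro j hj
    have h := (hinit j (Finset.mem_Icc.1 hj).1).1
    have : 0 ≤ ρb * lam ^ ((j : ℝ) / 5) * lam ^ (-(4 / 5 : ℝ) * j) := by positivity
    linarith
  have hclosed : ∀ t ∈ Ioc 0 T, (∀ s ∈ Ico 0 t, P s) → P t := by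
    intro t ht h
    simp only [hP] at h ⊢
    exact fun j hj => le_const_of_forall_Ico (g := fun s => |a (-(j : ℤ)) s|) (hall _).1.abs ht
      fun s hs => h s hs j hj
  have henv_of : ∀ t₁, t₁ ≤ T → (∀ s ∈ Icc 0 t₁, P s) →
      ∀ s ∈ Icc 0 t₁, ∀ j : ℕ, 1 ≤ j → |a (-(j : ℤ)) s| ≤ 2 * ρb * lam ^ ((j : ℝ) / 5) := by
    intro t₁ ht₁ h s hs j hj
    rcases le_or_gt j L with hjL | hjL
    · have h' := h s hs
      simp only [hP] at h'
      exact h' j (Finset.mem_Icc.2 ⟨hj, hjL⟩)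
    · have hn : (L : ℤ) < |(-(j : ℤ))| := by rw [habs]; exact_mod_cast hjL
      rw [(hzero _ hn s ⟨hs.1, hs.2.trans ht₁⟩).1, abs_zero]
      positivity
  set ts : ℝ := maximalTimeP P 0 T with hts
  have hts_mem : ts ∈ Icc 0 T := maximalTimeP_mem hT.le hP0
  have hts_spec : ∀ s ∈ Icc 0 ts, P s := fun s hs => maximalTimeP_spec hT.le hP0 hclosed hs
  have hexit : ts = T ∨ ¬ ∀ᶠ t in 𝓝[Icc 0 T] ts, P t := maximalTimeP_exit hT.le hP0
  have hts_eq : ts = T := by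
    refine hexit.elim id fun h => absurd ?_ h
    · simp only [hP]
      refine (Filter.eventually_all_finset _).2 fun j hj => ?_
      have hj1 : 1 ≤ j := (Finset.mem_Icc.1 hj).1
      have hc := (core ts hts_mem.2 (henv_of ts hts_mem.2 hts_spec) ts ⟨hts_mem.1, le_rfl⟩
        j hj1).2
      have hi := (hinit j hj1).1
      have hstrict : |a (-(j : ℤ)) ts| < 2 * ρb * lam ^ ((j : ℝ) / 5) := by
        have h1 : F * lam ^ ((j : ℝ) / 5) * lam ^ (-(4 / 5 : ℝ) * j) * ts ≤
            ρb / 2 * (lam ^ ((j : ℝ) / 5) * lam ^ (-(4 / 5 : ℝ) * j)) :=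
          calc F * lam ^ ((j : ℝ) / 5) * lam ^ (-(4 / 5 : ℝ) * j) * ts
              ≤ F * lam ^ ((j : ℝ) / 5) * lam ^ (-(4 / 5 : ℝ) * j) * T :=
                mul_le_mul_of_nonneg_left hts_mem.2 (by positivity)
            _ = F * T * (lam ^ ((j : ℝ) / 5) * lam ^ (-(4 / 5 : ℝ) * j)) := by ring
            _ ≤ ρb / 2 * (lam ^ ((j : ℝ) / 5) * lam ^ (-(4 / 5 : ℝ) * j)) :=
                mul_le_mul_of_nonneg_right hFT (by positivity)
        have h2 : 0 < ρb * (lam ^ ((j : ℝ) / 5) * lam ^ (-(4 / 5 : ℝ) * j)) := by positivity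
        linarith
      exact (((hall _).1.abs ts hts_mem).eventually_lt_const hstrict).mono fun s hs => hs.le
  have hPT : ∀ s ∈ Icc 0 T, P s := by rw [← hts_eq]; exact hts_spec
  have henvT := henv_of T le_rfl hPT
  intro t ht j hj
  obtain ⟨h1, h2⟩ := core T le_rfl henvT t ht j hj
  exact ⟨hbpos _ t ht, h1, h2⟩

end Summit.NavierStokesRegularity.NavierStokesRegularity.Theorems.PerpetualPumpCircuitPump
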